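import Mathlib
import Summits.KontsevichZagierPeriods.Zeta5Search.Certificates.RecordRayChain
import Summits.KontsevichZagierPeriods.Zeta5Search.Certificates.RecordRayMirror
import Summits.KontsevichZagierPeriods.Zeta5Search.Certificates.RecordRayDenominators
import HarnessLib

/-!
# Clause (N), window form: the record linear form is nonzero for infinitely many `n` (fam-tele g15, S4-R1 file 3 = K5)

HONEST FRAMING: systematic search; no irrationality claim unless certified.  This file proves that the linear
forms `L_n = recordForm n = Q_n ζ(5) − P_n` (`RecordRayForms.recordForm_eq`) of Brown–Zudilin's record ray are
NONZERO FOR INFINITELY MANY `n` — and nothing more: no size statement, no denominator statement, NO claim about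
the arithmetic nature of `ζ(5)` (for which one would also need (D′), which is refuted numerically, see the
programme notes).

**Theorem (`recordForm_frequently_ne_zero`).** `∃ᶠ n, recordForm n ≠ 0`.

Proof.  `RecordRayConnection.frequently_ne_zero_of_window` (here in the variant `…_window'` with a FREQUENTLY
nonzero window determinant, same proof) reduces it to: the real frames `T_ℝ(b_n)` are invertible
(`realFrame_bRecord_det_ne`), obey the chain rule `T_ℝ(b_{n+1}) = c_n • P̃(n) • T_ℝ(b_n)` with `c_n ≠ 0`
(`RecordRayChain.realFrame_chain`, `cRec_ne`), `L_n = −ρ_n · adj(T_ℝ(b_n))₀₂` (`recordForm_eq_adjugate`,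
`rhoOf_aRec_ne_zero`), and the window determinant `D(n)` of `(P̃(n), P̃(n+1))` is nonzero for infinitely many
`n`.  The last point: `P̃(ν) = Pgen ν` is defined over every commutative ring and commutes with ring maps
(`map_Pgen`), so `D(n) ∈ ℤ` reduces mod 97 to `D(n mod 97)`, and `D(1) = 84 ≠ 0` in `ℤ/97` by the kernel
computation `RecordRayMirror.DwinM_mod97`; hence `D(n) ≠ 0` for all `n ≡ 1 (mod 97)`.
-/

namespace Summit.KontsevichZagierPeriods.Zeta5Search.RecordRay.Generic

open Matrix Filter
open Summit.KontsevichZagierPeriods.Zeta5Search.WedgeDictionary (rhoOf)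
open Summit.KontsevichZagierPeriods.Zeta5Search.DualSeriesLemma19 (bRecord)
open Summit.KontsevichZagierPeriods.Zeta5Search.RecordRay (aRec recordForm rhoOf_aRec_ne_zero)
open Summit.KontsevichZagierPeriods.Zeta5Search.RecordRay.Connection

/-! ### 1. The window determinant, generically, and its naturality -/

section Generic

variable {R S : Type*} [CommRing R] [CommRing S] (f : R →+* S)

/-- The window determinant `D(ν)` of the period matrices `(P̃(ν), P̃(ν+1))`. -/
noncomputable def Dwin (ν : R) : R := (windowMat (Pgen ν) (Pgen (ν + 1))).det

/-- The mirror window matrix agrees with `windowMat`. -/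
theorem toMatrix_windowM (P0 P1 : M3 R) : (windowM P0 P1).toMatrix = windowMat P0.toMatrix P1.toMatrix := by
  rw [windowMat, ← M3.toMatrix_adj, ← M3.toMatrix_adj, ← M3.toMatrix_mul]
  ext i j; fin_cases i <;> fin_cases j <;> simp [windowM, M3.toMatrix]

/-- The mirror computes `D`. -/
theorem DwinM_eq (ν : R) : DwinM ν = Dwin ν := by
  rw [DwinM, Dwin, ← M3.det_toMatrix, toMatrix_windowM, toMatrix_PgenM, toMatrix_PgenM]

/-- Naturality of `windowMat` along a ring hom. -/
theorem map_windowMat (P0 P1 : Matrix (Fin 3) (Fin 3) R) :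
    f.mapMatrix (windowMat P0 P1) = windowMat (f.mapMatrix P0) (f.mapMatrix P1) := by
  have h1 : (f.mapMatrix P0).adjugate = f.mapMatrix P0.adjugate := (RingHom.map_adjugate f P0).symm
  have h2 : (f.mapMatrix P0).adjugate * (f.mapMatrix P1).adjugate = f.mapMatrix (P0.adjugate * P1.adjugate) := by
    rw [map_mul, RingHom.map_adjugate, RingHom.map_adjugate]
  rw [windowMat, windowMat, h2, h1]
  ext i j
  simp only [RingHom.mapMatrix_apply, Matrix.map_apply, Matrix.of_apply]
  split_ifs <;> simp

/-- `D` commutes with ring maps (it is a fixed integer polynomial in `ν`). -/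
theorem map_Dwin (ν : R) : f (Dwin ν) = Dwin (f ν) := by
  rw [Dwin, Dwin, RingHom.map_det, map_windowMat, map_Pgen, map_Pgen, map_add, map_one]

end Generic

/-! ### 2. `D(n) ≠ 0` for `n ≡ 1 (mod 97)` -/

/-- A nonzero value of the window determinant in `ZMod p` lifts: `Dwin ν ≠ 0` in characteristic `0` on that residue class. -/
theorem Dwin_ne_of_mod {n : ℕ} (h : (n : ZMod 97) = 1) : Dwin (n : ℚ) ≠ 0 := by
  intro h0
  have hZ : Dwin (n : ℤ) = 0 := by
    have e := map_Dwin (Int.castRingHom ℚ) (n : ℤ)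
    rw [eq_intCast, eq_intCast, Int.cast_natCast, h0] at e
    exact_mod_cast e
  have e2 := map_Dwin (Int.castRingHom (ZMod 97)) (n : ℤ)
  rw [hZ, map_zero, eq_intCast, Int.cast_natCast, h, ← DwinM_eq] at e2
  exact DwinM_mod97 e2.symm

/-- The window determinant is nonzero for infinitely many `ν` (the residue class of `1 mod 97`). -/
theorem Dwin_frequently_ne : ∃ᶠ n : ℕ in atTop, Dwin (n : ℚ) ≠ 0 := by
  refine Filter.frequently_atTop.2 fun N => ⟨97 * N + 1, by omega, Dwin_ne_of_mod ?_⟩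
  have h97 : ((97 : ℕ) : ZMod 97) = 0 := ZMod.natCast_self 97
  rw [Nat.cast_add, Nat.cast_mul, h97, zero_mul, zero_add, Nat.cast_one]

/-- The real connection matrix is the cast of the rational one. -/
theorem Pgen_map_real (q : ℚ) : (Pgen q).map ((↑) : ℚ → ℝ) = Pgen (q : ℝ) := by
  have e := map_Pgen (Rat.castHom ℝ) q
  rwa [RingHom.mapMatrix_apply, Rat.coe_castHom] at e

/-- The real window determinant is the cast of the rational one. -/
theorem Dwin_real (q : ℚ) : ((Dwin q : ℚ) : ℝ) = Dwin (q : ℝ) := by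
  have e := map_Dwin (Rat.castHom ℝ) q
  rwa [Rat.coe_castHom] at e

/-! ### 3. The window lemma with a frequently-nonzero determinant -/

/-- `RecordRayConnection.frequently_ne_zero_of_window` with `hD` weakened from "eventually" to "frequently"
(same proof: one good window `{n, n+1, n+2}` beyond every `N`). -/
theorem frequently_ne_zero_of_window' (f : ℕ → ℝ) (T P : ℕ → Matrix (Fin 3) (Fin 3) ℝ) (c κ : ℕ → ℝ)
    (n₀ : ℕ) (hT : ∀ n ≥ n₀, (T n).det ≠ 0) (hc : ∀ n ≥ n₀, c n ≠ 0) (hκ : ∀ n ≥ n₀, κ n ≠ 0)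
    (hstep : ∀ n ≥ n₀, T (n + 1) = c n • (P n * T n))
    (hf : ∀ n ≥ n₀, f n = κ n * (T n).adjugate 0 2)
    (hD : ∃ᶠ n in Filter.atTop, (windowMat (P n) (P (n + 1))).det ≠ 0) :
    ∃ᶠ n in Filter.atTop, f n ≠ 0 := by
  rw [Filter.frequently_atTop] at hD ⊢
  intro N
  obtain ⟨n, hn, hDn⟩ := hD (max N n₀)
  have hnN : N ≤ n := le_trans (le_max_left _ _) hn
  have hn0 : n₀ ≤ n := le_trans (le_max_right _ _) hn
  have hw := window_of_transport (pow_ne_zero 2 (hc n hn0)) (pow_ne_zero 2 (hc (n + 1) (by omega)))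
    (adjugate_row_of_step (hstep n hn0) 0) (adjugate_row_of_step (hstep (n + 1) (by omega)) 0)
    (adjugate_row_ne_zero (hT n hn0) 0) hDn
  rcases hw with h | h | h
  · exact ⟨n, hnN, by rw [hf n hn0]; exact mul_ne_zero (hκ n hn0) h⟩
  · exact ⟨n + 1, by omega, by rw [hf (n + 1) (by omega)]; exact mul_ne_zero (hκ (n + 1) (by omega)) h⟩
  · exact ⟨n + 2, by omega, by rw [hf (n + 2) (by omega)]; exact mul_ne_zero (hκ (n + 2) (by omega)) h⟩

/-! ### 4. Clause (N), window form -/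

/-- **(N∃ᶠ) for the record ray.**  The linear forms `L_n = Q_n ζ(5) − P_n` of Brown–Zudilin's record cell along
`a·n` are nonzero for infinitely many `n` (indeed for some `n` in every window `{m, m+1, m+2}`, `m ≡ 1 (97)`).
HONEST FRAMING: this is NOT an irrationality statement. -/
theorem recordForm_frequently_ne_zero : ∃ᶠ n in Filter.atTop, recordForm n ≠ 0 := by
  refine frequently_ne_zero_of_window' recordForm (fun n => realFrame (bRecord n))
    (fun n => (Pgen (n : ℚ)).map ((↑) : ℚ → ℝ)) (fun n => (cRec n : ℝ)) (fun n => -(rhoOf (aRec n) : ℝ)) 1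
    (fun n hn => realFrame_bRecord_det_ne hn) (fun n hn => by exact_mod_cast cRec_ne hn)
    (fun n _ => neg_ne_zero.2 (by exact_mod_cast rhoOf_aRec_ne_zero n)) (fun n hn => realFrame_chain hn)
    (fun n _ => by rw [recordForm_eq_adjugate, neg_mul]) ?_
  refine Dwin_frequently_ne.mono fun n hn => ?_
  have h' : Dwin (n : ℝ) ≠ 0 := by
    have := (Rat.cast_ne_zero (α := ℝ)).2 hn
    rwa [Dwin_real, Rat.cast_natCast] at this
  show (windowMat ((Pgen (n : ℚ)).map ((↑) : ℚ → ℝ)) ((Pgen ((n + 1 : ℕ) : ℚ)).map ((↑) : ℚ → ℝ))).det ≠ 0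
  rw [Pgen_map_real, Pgen_map_real]
  push_cast
  exact h'

/-- The same in the shape of clause (N): `Q_n ζ(5) − P_n ≠ 0` for infinitely many `n`. -/
theorem recordPair_frequently_ne_zero :
    ∃ᶠ n in Filter.atTop,
      (Summit.KontsevichZagierPeriods.Zeta5Search.RecordRay.recordQ n : ℝ) *
          Literature.NumberTheory.Transcendental.zetaValue 5 -
        (Summit.KontsevichZagierPeriods.Zeta5Search.RecordRay.recordP n : ℝ) ≠ 0 := by
  refine (recordForm_frequently_ne_zero.and_eventually (Filter.eventually_ge_atTop 1)).mono fun n hn => ?_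
  rw [← Summit.KontsevichZagierPeriods.Zeta5Search.RecordRay.recordForm_eq hn.2]
  exact hn.1

end Summit.KontsevichZagierPeriods.Zeta5Search.RecordRay.Generic
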